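import Summits.RiemannHypothesis.RiemannHypothesis.Theorems.SignConeOscillatory.Negative.OriginDominatingNumerics
import Mathlib.MeasureTheory.Integral.IntervalIntegral.Basic
import Mathlib.NumberTheory.Harmonic.EulerMascheroni
import Mathlib.Analysis.Real.Pi.Bounds

/-!
# `SignConeOscillatory` (crux stmt-RiemannHypothesis-16302) — negative lemma §A′, the 23 cells

Numeric layer, part 2 (companion of `OriginDominatingNumerics.lean` and of
`Theorems/SignConeOscillatory/Negative/WithoutPDOriginDominating.lean`).  For the combined polar + archimedean
density `D(t) = y·B(v) + 2v²/(v⁴-1)` (`v = e^{t/2}`, `y = F(t)`) of a real even origin-dominating witness with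
`F(0) = 1`, this file records the 23 CELL BOUNDS `D ≤ Mᵢ` on the partition
`0 < 0.28 < 0.32 < … < 2.18` of the witness used in the main file (`ncell0` … `ncell22`; each takes only the
information `y = 1`, `0 ≤ y ≤ 1`, `y ≤ 0` or `y = -1` available on that cell), the numeric tail bound
`2e^{-2.18}/(1 - e^{-4.36}) ≤ 0.22902`, the budget `log 4π + γ ≥ 2.9849`, and the Riemann-sum lemma
`integral_le_sum_cells`.  With `Σᵢ Mᵢ Δxᵢ ≤ 1.395` the main file gets `Re W_ar(F) + F(0) ≤ -0.36 < 0`.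
No definitions.
-/

noncomputable section

-- `Summit.RiemannHypothesis.RiemannHypothesis.…` repeats a namespace component by design (D-0017 layout).
set_option linter.dupNamespace false

open Set MeasureTheory intervalIntegral

namespace Summit.RiemannHypothesis.RiemannHypothesis.Theorems.SignConeOscillatory.Negative

/-! ## Bookkeeping lemmas -/

/-- Riemann sums: `D ≤ Mᵢ` on each open cell of a monotone partition gives `∫_{x₀}^{xₙ} D ≤ Σᵢ Mᵢ (xᵢ₊₁ - xᵢ)`. -/
theorem integral_le_sum_cells {D : ℝ → ℝ} {x M : ℕ → ℝ} {n : ℕ}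
    (hint : ∀ i < n, IntervalIntegrable D volume (x i) (x (i + 1)))
    (hmono : ∀ i < n, x i ≤ x (i + 1))
    (hbound : ∀ i < n, ∀ t ∈ Ioo (x i) (x (i + 1)), D t ≤ M i) :
    ∫ t in (x 0)..(x n), D t ≤ ∑ i ∈ Finset.range n, M i * (x (i + 1) - x i) := by
  rw [← sum_integral_adjacent_intervals hint]
  refine Finset.sum_le_sum fun i hi => ?_
  rw [Finset.mem_range] at hi
  calc ∫ t in (x i)..(x (i + 1)), D t ≤ ∫ _ in (x i)..(x (i + 1)), M i :=
        integral_mono_on_of_le_Ioo (hmono i hi) (hint i hi) intervalIntegrable_const (hbound i hi)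
    _ = M i * (x (i + 1) - x i) := by rw [intervalIntegral.integral_const, smul_eq_mul, mul_comm]

/-- `log 4 = 2 log 2`, `log 8 = 3 log 2`, `log 9 = 2 log 3`. -/
theorem log_four_eight_nine :
    Real.log 4 = 2 * Real.log 2 ∧ Real.log 8 = 3 * Real.log 2 ∧ Real.log 9 = 2 * Real.log 3 := by
  refine ⟨?_, ?_, ?_⟩
  · rw [show (4 : ℝ) = 2 ^ 2 by norm_num, Real.log_pow]; norm_num
  · rw [show (8 : ℝ) = 2 ^ 3 by norm_num, Real.log_pow]; norm_num
  · rw [show (9 : ℝ) = 3 ^ 2 by norm_num, Real.log_pow]; norm_num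

/-- The budget: `2.9849066 ≤ log 4π + γ` (`log 4π = 2 log 2 + log π ≥ 2 log 2 + log 3`, `γ > 1/2`). -/
theorem budget_le : (2.9849066 : ℝ) ≤ Real.log (4 * Real.pi) + Real.eulerMascheroniConstant := by
  have h4 : Real.log (4 * Real.pi) = Real.log 4 + Real.log Real.pi :=
    Real.log_mul (by norm_num) Real.pi_ne_zero
  obtain ⟨hl4, -, -⟩ := log_four_eight_nine
  have hpi : Real.log 3 ≤ Real.log Real.pi := Real.log_le_log (by norm_num) (le_of_lt Real.pi_gt_three)
  have hγ := Real.one_half_lt_eulerMascheroniConstant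
  rw [h4, hl4]
  linarith [Real.log_two_gt_d9, Real.log_three_gt_d9]

/-- The numeric tail: `(2/(1 - e^{-4.36})) e^{-2.18} ≤ 0.22902`. -/
theorem tail_numeric : 2 / (1 - Real.exp (-(2 * 2.18))) * Real.exp (-(2.18 : ℝ)) ≤ 0.22902 := by
  have e1 : Real.exp (-(2.18 : ℝ)) = (Real.exp 1.09 ^ 2)⁻¹ := by
    rw [Real.exp_neg, ← Real.exp_nat_mul]; norm_num
  have e2 : Real.exp (-(2 * 2.18 : ℝ)) = (Real.exp 1.09 ^ 4)⁻¹ := by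
    rw [Real.exp_neg, ← Real.exp_nat_mul]; norm_num
  rw [e1, e2]
  have hu0 : (2.974274070 : ℝ) ≤ Real.exp 1.09 := exp_1_09_ge
  have hA : (Real.exp 1.09 ^ 2)⁻¹ ≤ ((2.974274070 : ℝ) ^ 2)⁻¹ := by
    apply inv_anti₀ (by positivity)
    gcongr
  have hB : 1 - ((2.974274070 : ℝ) ^ 4)⁻¹ ≤ 1 - (Real.exp 1.09 ^ 4)⁻¹ := by
    have : (Real.exp 1.09 ^ 4)⁻¹ ≤ ((2.974274070 : ℝ) ^ 4)⁻¹ := by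
      apply inv_anti₀ (by positivity)
      gcongr
    linarith
  have hBpos : (0 : ℝ) < 1 - ((2.974274070 : ℝ) ^ 4)⁻¹ := by norm_num
  calc 2 / (1 - (Real.exp 1.09 ^ 4)⁻¹) * (Real.exp 1.09 ^ 2)⁻¹
      ≤ 2 / (1 - ((2.974274070 : ℝ) ^ 4)⁻¹) * ((2.974274070 : ℝ) ^ 2)⁻¹ :=
        mul_le_mul (div_le_div_of_nonneg_left (by norm_num) hBpos hB) hA (by positivity) (by positivity)
    _ ≤ 0.22902 := by norm_num
/-! ## The 23 cells -/

/-- Cell 0: `t ∈ (0, 0.28)`, `F = 1`. -/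
theorem ncell0 {y t : ℝ} (ht : t ∈ Set.Ioo (0 : ℝ) 0.28) (hy : y = 1) :
    y * (2 * (Real.exp (t / 2) + (Real.exp (t / 2))⁻¹) - 2 * Real.exp (t / 2) ^ 3 / (Real.exp (t / 2) ^ 4 - 1)) +
      2 * Real.exp (t / 2) ^ 2 / (Real.exp (t / 2) ^ 4 - 1) ≤ 4.03928 := by
  subst hy
  have hv1 : 1 < Real.exp (t / 2) := Real.one_lt_exp_iff.2 (by linarith [ht.1])
  have hvb : Real.exp (t / 2) ≤ 1.150273801 := le_trans (Real.exp_le_exp.2 (by linarith [ht.2])) exp_0_14_le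
  exact le_trans (cell_pos_one hv1 hvb) (by norm_num)

/-- Cell 1: `t ∈ (0.28, 0.32)`, `0 ≤ F ≤ 1`. -/
theorem ncell1 {y t : ℝ} (ht : t ∈ Set.Ioo (0.28 : ℝ) 0.32) (hy0 : 0 ≤ y) (hy1 : y ≤ 1) :
    y * (2 * (Real.exp (t / 2) + (Real.exp (t / 2))⁻¹) - 2 * Real.exp (t / 2) ^ 3 / (Real.exp (t / 2) ^ 4 - 1)) +
      2 * Real.exp (t / 2) ^ 2 / (Real.exp (t / 2) ^ 4 - 1) ≤ 3.97114 := by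
  have hv : (1.150273796 : ℝ) ≤ Real.exp (t / 2) := le_trans exp_0_14_ge (Real.exp_le_exp.2 (by linarith [ht.1]))
  have hvb : Real.exp (t / 2) ≤ 1.173510873 := le_trans (Real.exp_le_exp.2 (by linarith [ht.2])) exp_0_16_le
  exact le_trans (cell_pos_shoulder (by norm_num) hv hvb (by norm_num) hy0 hy1) (by norm_num)

/-- Cell 2: `t ∈ (0.32, 0.36)`, `-1 ≤ F ≤ 0`. -/
theorem ncell2 {y t : ℝ} (ht : t ∈ Set.Ioo (0.32 : ℝ) 0.36) (hy : y ≤ 0) :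
    y * (2 * (Real.exp (t / 2) + (Real.exp (t / 2))⁻¹) - 2 * Real.exp (t / 2) ^ 3 / (Real.exp (t / 2) ^ 4 - 1)) +
      2 * Real.exp (t / 2) ^ 2 / (Real.exp (t / 2) ^ 4 - 1) ≤ 3.07231 := by
  have hv : (1.173510868 : ℝ) ≤ Real.exp (t / 2) := le_trans exp_0_16_ge (Real.exp_le_exp.2 (by linarith [ht.1]))
  exact le_trans (cell_neg_shoulder (by norm_num) hv (by norm_num) hy) (by norm_num)

/-- Cell 3: `t ∈ (0.36, 0.5)`, `F = -1`. -/
theorem ncell3 {y t : ℝ} (ht : t ∈ Set.Ioo (0.36 : ℝ) 0.5) (hy : y = -1) :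
    y * (2 * (Real.exp (t / 2) + (Real.exp (t / 2))⁻¹) - 2 * Real.exp (t / 2) ^ 3 / (Real.exp (t / 2) ^ 4 - 1)) +
      2 * Real.exp (t / 2) ^ 2 / (Real.exp (t / 2) ^ 4 - 1) ≤ 1.90855 := by
  subst hy
  have hv : (1.197217361 : ℝ) ≤ Real.exp (t / 2) := le_trans exp_0_18_ge (Real.exp_le_exp.2 (by linarith [ht.1]))
  exact le_trans (cell_neg_one (by norm_num) hv) (by norm_num)

/-- Cell 4: `t ∈ (0.5, 0.64)`, `F = -1`. -/
theorem ncell4 {y t : ℝ} (ht : t ∈ Set.Ioo (0.5 : ℝ) 0.64) (hy : y = -1) :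
    y * (2 * (Real.exp (t / 2) + (Real.exp (t / 2))⁻¹) - 2 * Real.exp (t / 2) ^ 3 / (Real.exp (t / 2) ^ 4 - 1)) +
      2 * Real.exp (t / 2) ^ 2 / (Real.exp (t / 2) ^ 4 - 1) ≤ 0.25749 := by
  subst hy
  have hv : (1.284025414 : ℝ) ≤ Real.exp (t / 2) := le_trans exp_0_25_ge (Real.exp_le_exp.2 (by linarith [ht.1]))
  exact le_trans (cell_neg_one (by norm_num) hv) (by norm_num)

/-- Cell 5: `t ∈ (0.64, 0.68)`, `-1 ≤ F ≤ 0`. -/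
theorem ncell5 {y t : ℝ} (ht : t ∈ Set.Ioo (0.64 : ℝ) 0.68) (hy : y ≤ 0) :
    y * (2 * (Real.exp (t / 2) + (Real.exp (t / 2))⁻¹) - 2 * Real.exp (t / 2) ^ 3 / (Real.exp (t / 2) ^ 4 - 1)) +
      2 * Real.exp (t / 2) ^ 2 / (Real.exp (t / 2) ^ 4 - 1) ≤ 1.46073 := by
  have hv : (1.377127762 : ℝ) ≤ Real.exp (t / 2) := le_trans exp_0_32_ge (Real.exp_le_exp.2 (by linarith [ht.1]))
  exact le_trans (cell_neg_shoulder (by norm_num) hv (by norm_num) hy) (by norm_num)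

/-- Cell 6: `t ∈ (0.68, 0.7)`, `-1 ≤ F ≤ 0`. -/
theorem ncell6 {y t : ℝ} (ht : t ∈ Set.Ioo (0.68 : ℝ) 0.7) (hy : y ≤ 0) :
    y * (2 * (Real.exp (t / 2) + (Real.exp (t / 2))⁻¹) - 2 * Real.exp (t / 2) ^ 3 / (Real.exp (t / 2) ^ 4 - 1)) +
      2 * Real.exp (t / 2) ^ 2 / (Real.exp (t / 2) ^ 4 - 1) ≤ 1.36310 := by
  have hv : (1.404947588 : ℝ) ≤ Real.exp (t / 2) := le_trans exp_0_34_ge (Real.exp_le_exp.2 (by linarith [ht.1]))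
  exact le_trans (cell_neg_shoulder (by norm_num) hv (by norm_num) hy) (by norm_num)

/-- Cell 7: `t ∈ (0.7, 0.74)`, `-1 ≤ F ≤ 0`. -/
theorem ncell7 {y t : ℝ} (ht : t ∈ Set.Ioo (0.7 : ℝ) 0.74) (hy : y ≤ 0) :
    y * (2 * (Real.exp (t / 2) + (Real.exp (t / 2))⁻¹) - 2 * Real.exp (t / 2) ^ 3 / (Real.exp (t / 2) ^ 4 - 1)) +
      2 * Real.exp (t / 2) ^ 2 / (Real.exp (t / 2) ^ 4 - 1) ≤ 1.31826 := by
  have hv : (1.419067546 : ℝ) ≤ Real.exp (t / 2) := le_trans exp_0_35_ge (Real.exp_le_exp.2 (by linarith [ht.1]))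
  exact le_trans (cell_neg_shoulder (by norm_num) hv (by norm_num) hy) (by norm_num)

/-- Cell 8: `t ∈ (0.74, 0.86)`, `F = -1`. -/
theorem ncell8 {y t : ℝ} (ht : t ∈ Set.Ioo (0.74 : ℝ) 0.86) (hy : y = -1) :
    y * (2 * (Real.exp (t / 2) + (Real.exp (t / 2))⁻¹) - 2 * Real.exp (t / 2) ^ 3 / (Real.exp (t / 2) ^ 4 - 1)) +
      2 * Real.exp (t / 2) ^ 2 / (Real.exp (t / 2) ^ 4 - 1) ≤ -1.25283 := by
  subst hy
  have hv : (1.447734612 : ℝ) ≤ Real.exp (t / 2) := le_trans exp_0_37_ge (Real.exp_le_exp.2 (by linarith [ht.1]))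
  exact le_trans (cell_neg_one (by norm_num) hv) (by norm_num)

/-- Cell 9: `t ∈ (0.86, 0.98)`, `F = -1`. -/
theorem ncell9 {y t : ℝ} (ht : t ∈ Set.Ioo (0.86 : ℝ) 0.98) (hy : y = -1) :
    y * (2 * (Real.exp (t / 2) + (Real.exp (t / 2))⁻¹) - 2 * Real.exp (t / 2) ^ 3 / (Real.exp (t / 2) ^ 4 - 1)) +
      2 * Real.exp (t / 2) ^ 2 / (Real.exp (t / 2) ^ 4 - 1) ≤ -1.75979 := by
  subst hy
  have hv : (1.537257521 : ℝ) ≤ Real.exp (t / 2) := le_trans exp_0_43_ge (Real.exp_le_exp.2 (by linarith [ht.1]))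
  exact le_trans (cell_neg_one (by norm_num) hv) (by norm_num)

/-- Cell 10: `t ∈ (0.98, 1.02)`, `-1 ≤ F ≤ 0`. -/
theorem ncell10 {y t : ℝ} (ht : t ∈ Set.Ioo (0.98 : ℝ) 1.02) (hy : y ≤ 0) :
    y * (2 * (Real.exp (t / 2) + (Real.exp (t / 2))⁻¹) - 2 * Real.exp (t / 2) ^ 3 / (Real.exp (t / 2) ^ 4 - 1)) +
      2 * Real.exp (t / 2) ^ 2 / (Real.exp (t / 2) ^ 4 - 1) ≤ 0.87370 := by
  have hv : (1.632316217 : ℝ) ≤ Real.exp (t / 2) := le_trans exp_0_49_ge (Real.exp_le_exp.2 (by linarith [ht.1]))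
  exact le_trans (cell_neg_shoulder (by norm_num) hv (by norm_num) hy) (by norm_num)

/-- Cell 11: `t ∈ (1.02, 1.2)`, `-1 ≤ F ≤ 0`. -/
theorem ncell11 {y t : ℝ} (ht : t ∈ Set.Ioo (1.02 : ℝ) 1.2) (hy : y ≤ 0) :
    y * (2 * (Real.exp (t / 2) + (Real.exp (t / 2))⁻¹) - 2 * Real.exp (t / 2) ^ 3 / (Real.exp (t / 2) ^ 4 - 1)) +
      2 * Real.exp (t / 2) ^ 2 / (Real.exp (t / 2) ^ 4 - 1) ≤ 0.82900 := by
  have hv : (1.665291192 : ℝ) ≤ Real.exp (t / 2) := le_trans exp_0_51_ge (Real.exp_le_exp.2 (by linarith [ht.1]))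
  exact le_trans (cell_neg_shoulder (by norm_num) hv (by norm_num) hy) (by norm_num)

/-- Cell 12: `t ∈ (1.2, 1.4)`, `-1 ≤ F ≤ 0`. -/
theorem ncell12 {y t : ℝ} (ht : t ∈ Set.Ioo (1.2 : ℝ) 1.4) (hy : y ≤ 0) :
    y * (2 * (Real.exp (t / 2) + (Real.exp (t / 2))⁻¹) - 2 * Real.exp (t / 2) ^ 3 / (Real.exp (t / 2) ^ 4 - 1)) +
      2 * Real.exp (t / 2) ^ 2 / (Real.exp (t / 2) ^ 4 - 1) ≤ 0.66250 := by
  have hv : (1.822118798 : ℝ) ≤ Real.exp (t / 2) := le_trans exp_0_6_ge (Real.exp_le_exp.2 (by linarith [ht.1]))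
  exact le_trans (cell_neg_shoulder (by norm_num) hv (by norm_num) hy) (by norm_num)

/-- Cell 13: `t ∈ (1.4, 1.42)`, `-1 ≤ F ≤ 0`. -/
theorem ncell13 {y t : ℝ} (ht : t ∈ Set.Ioo (1.4 : ℝ) 1.42) (hy : y ≤ 0) :
    y * (2 * (Real.exp (t / 2) + (Real.exp (t / 2))⁻¹) - 2 * Real.exp (t / 2) ^ 3 / (Real.exp (t / 2) ^ 4 - 1)) +
      2 * Real.exp (t / 2) ^ 2 / (Real.exp (t / 2) ^ 4 - 1) ≤ 0.52514 := by
  have hv : (2.013752705 : ℝ) ≤ Real.exp (t / 2) := le_trans exp_0_7_ge (Real.exp_le_exp.2 (by linarith [ht.1]))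
  exact le_trans (cell_neg_shoulder (by norm_num) hv (by norm_num) hy) (by norm_num)

/-- Cell 14: `t ∈ (1.42, 1.48)`, `F = -1`. -/
theorem ncell14 {y t : ℝ} (ht : t ∈ Set.Ioo (1.42 : ℝ) 1.48) (hy : y = -1) :
    y * (2 * (Real.exp (t / 2) + (Real.exp (t / 2))⁻¹) - 2 * Real.exp (t / 2) ^ 3 / (Real.exp (t / 2) ^ 4 - 1)) +
      2 * Real.exp (t / 2) ^ 2 / (Real.exp (t / 2) ^ 4 - 1) ≤ -3.49353 := by
  subst hy
  have hv : (2.033991256 : ℝ) ≤ Real.exp (t / 2) := le_trans exp_0_71_ge (Real.exp_le_exp.2 (by linarith [ht.1]))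
  exact le_trans (cell_neg_one (by norm_num) hv) (by norm_num)

/-- Cell 15: `t ∈ (1.48, 1.54)`, `F = -1`. -/
theorem ncell15 {y t : ℝ} (ht : t ∈ Set.Ioo (1.48 : ℝ) 1.54) (hy : y = -1) :
    y * (2 * (Real.exp (t / 2) + (Real.exp (t / 2))⁻¹) - 2 * Real.exp (t / 2) ^ 3 / (Real.exp (t / 2) ^ 4 - 1)) +
      2 * Real.exp (t / 2) ^ 2 / (Real.exp (t / 2) ^ 4 - 1) ≤ -3.65955 := by
  subst hy
  have hv : (2.095935512 : ℝ) ≤ Real.exp (t / 2) := le_trans exp_0_74_ge (Real.exp_le_exp.2 (by linarith [ht.1]))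
  exact le_trans (cell_neg_one (by norm_num) hv) (by norm_num)

/-- Cell 16: `t ∈ (1.54, 1.56)`, `-1 ≤ F ≤ 0`. -/
theorem ncell16 {y t : ℝ} (ht : t ∈ Set.Ioo (1.54 : ℝ) 1.56) (hy : y ≤ 0) :
    y * (2 * (Real.exp (t / 2) + (Real.exp (t / 2))⁻¹) - 2 * Real.exp (t / 2) ^ 3 / (Real.exp (t / 2) ^ 4 - 1)) +
      2 * Real.exp (t / 2) ^ 2 / (Real.exp (t / 2) ^ 4 - 1) ≤ 0.44943 := by
  have hv : (2.159766251 : ℝ) ≤ Real.exp (t / 2) := le_trans exp_0_77_ge (Real.exp_le_exp.2 (by linarith [ht.1]))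
  exact le_trans (cell_neg_shoulder (by norm_num) hv (by norm_num) hy) (by norm_num)

/-- Cell 17: `t ∈ (1.56, 1.82)`, `-1 ≤ F ≤ 0`. -/
theorem ncell17 {y t : ℝ} (ht : t ∈ Set.Ioo (1.56 : ℝ) 1.82) (hy : y ≤ 0) :
    y * (2 * (Real.exp (t / 2) + (Real.exp (t / 2))⁻¹) - 2 * Real.exp (t / 2) ^ 3 / (Real.exp (t / 2) ^ 4 - 1)) +
      2 * Real.exp (t / 2) ^ 2 / (Real.exp (t / 2) ^ 4 - 1) ≤ 0.43970 := by
  have hv : (2.181472263 : ℝ) ≤ Real.exp (t / 2) := le_trans exp_0_78_ge (Real.exp_le_exp.2 (by linarith [ht.1]))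
  exact le_trans (cell_neg_shoulder (by norm_num) hv (by norm_num) hy) (by norm_num)

/-- Cell 18: `t ∈ (1.82, 2.1)`, `-1 ≤ F ≤ 0`. -/
theorem ncell18 {y t : ℝ} (ht : t ∈ Set.Ioo (1.82 : ℝ) 2.1) (hy : y ≤ 0) :
    y * (2 * (Real.exp (t / 2) + (Real.exp (t / 2))⁻¹) - 2 * Real.exp (t / 2) ^ 3 / (Real.exp (t / 2) ^ 4 - 1)) +
      2 * Real.exp (t / 2) ^ 2 / (Real.exp (t / 2) ^ 4 - 1) ≤ 0.33280 := by
  have hv : (2.484322531 : ℝ) ≤ Real.exp (t / 2) := le_trans exp_0_91_ge (Real.exp_le_exp.2 (by linarith [ht.1]))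
  exact le_trans (cell_neg_shoulder (by norm_num) hv (by norm_num) hy) (by norm_num)

/-- Cell 19: `t ∈ (2.1, 2.12)`, `-1 ≤ F ≤ 0`. -/
theorem ncell19 {y t : ℝ} (ht : t ∈ Set.Ioo (2.1 : ℝ) 2.12) (hy : y ≤ 0) :
    y * (2 * (Real.exp (t / 2) + (Real.exp (t / 2))⁻¹) - 2 * Real.exp (t / 2) ^ 3 / (Real.exp (t / 2) ^ 4 - 1)) +
      2 * Real.exp (t / 2) ^ 2 / (Real.exp (t / 2) ^ 4 - 1) ≤ 0.24866 := by
  have hv : (2.857651116 : ℝ) ≤ Real.exp (t / 2) := le_trans exp_1_05_ge (Real.exp_le_exp.2 (by linarith [ht.1]))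
  exact le_trans (cell_neg_shoulder (by norm_num) hv (by norm_num) hy) (by norm_num)

/-- Cell 20: `t ∈ (2.12, 2.14)`, `F = -1`. -/
theorem ncell20 {y t : ℝ} (ht : t ∈ Set.Ioo (2.12 : ℝ) 2.14) (hy : y = -1) :
    y * (2 * (Real.exp (t / 2) + (Real.exp (t / 2))⁻¹) - 2 * Real.exp (t / 2) ^ 3 / (Real.exp (t / 2) ^ 4 - 1)) +
      2 * Real.exp (t / 2) ^ 2 / (Real.exp (t / 2) ^ 4 - 1) ≤ -5.51903 := by
  subst hy
  have hv : (2.886370987 : ℝ) ≤ Real.exp (t / 2) := le_trans exp_1_06_ge (Real.exp_le_exp.2 (by linarith [ht.1]))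
  exact le_trans (cell_neg_one (by norm_num) hv) (by norm_num)

/-- Cell 21: `t ∈ (2.14, 2.16)`, `F = -1`. -/
theorem ncell21 {y t : ℝ} (ht : t ∈ Set.Ioo (2.14 : ℝ) 2.16) (hy : y = -1) :
    y * (2 * (Real.exp (t / 2) + (Real.exp (t / 2))⁻¹) - 2 * Real.exp (t / 2) ^ 3 / (Real.exp (t / 2) ^ 4 - 1)) +
      2 * Real.exp (t / 2) ^ 2 / (Real.exp (t / 2) ^ 4 - 1) ≤ -5.58250 := by
  subst hy
  have hv : (2.915379497 : ℝ) ≤ Real.exp (t / 2) := le_trans exp_1_07_ge (Real.exp_le_exp.2 (by linarith [ht.1]))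
  exact le_trans (cell_neg_one (by norm_num) hv) (by norm_num)

/-- Cell 22: `t ∈ (2.16, 2.18)`, `-1 ≤ F ≤ 0`. -/
theorem ncell22 {y t : ℝ} (ht : t ∈ Set.Ioo (2.16 : ℝ) 2.18) (hy : y ≤ 0) :
    y * (2 * (Real.exp (t / 2) + (Real.exp (t / 2))⁻¹) - 2 * Real.exp (t / 2) ^ 3 / (Real.exp (t / 2) ^ 4 - 1)) +
      2 * Real.exp (t / 2) ^ 2 / (Real.exp (t / 2) ^ 4 - 1) ≤ 0.23377 := by
  have hv : (2.944679549 : ℝ) ≤ Real.exp (t / 2) := le_trans exp_1_08_ge (Real.exp_le_exp.2 (by linarith [ht.1]))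
  exact le_trans (cell_neg_shoulder (by norm_num) hv (by norm_num) hy) (by norm_num)

/-! ## The partition `x`, the bounds `M`, and the dispatch -/

/-- The partition: `x 0 = 0`, `x 23 = 2.18`, monotone, nonnegative. -/
theorem grid_facts {x : ℕ → ℝ} (hx : x = fun i => ([(0 : ℝ), 0.28, 0.32, 0.36, 0.5, 0.64, 0.68, 0.7, 0.74, 0.86, 0.98, 1.02, 1.2, 1.4, 1.42, 1.48, 1.54, 1.56, 1.82, 2.1, 2.12, 2.14, 2.16, 2.18] : List ℝ).getD i 2.18) :
    x 0 = 0 ∧ x 23 = 2.18 ∧ (∀ i < 23, x i ≤ x (i + 1)) ∧ (∀ i < 23, 0 ≤ x i) := by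
  refine ⟨by simp only [hx, List.getD_cons_zero], by simp only [hx, List.getD_cons_succ, List.getD_cons_zero],
    fun i hi => ?_, fun i hi => ?_⟩
  · interval_cases i <;> simp only [hx, List.getD_cons_succ, List.getD_cons_zero] <;> norm_num
  · interval_cases i <;> simp only [hx, List.getD_cons_succ, List.getD_cons_zero] <;> norm_num

/-- The Riemann sum of the cell bounds: `Σᵢ Mᵢ (xᵢ₊₁ - xᵢ) ≤ 1.39499`. -/
theorem cells_sum {x M : ℕ → ℝ} (hx : x = fun i => ([(0 : ℝ), 0.28, 0.32, 0.36, 0.5, 0.64, 0.68, 0.7, 0.74, 0.86, 0.98, 1.02, 1.2, 1.4, 1.42, 1.48, 1.54, 1.56, 1.82, 2.1, 2.12, 2.14, 2.16, 2.18] : List ℝ).getD i 2.18)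
    (hM : M = fun i => ([(4.03928 : ℝ), 3.97114, 3.07231, 1.90855, 0.25749, 1.46073, 1.36310, 1.31826, -1.25283, -1.75979, 0.87370, 0.82900, 0.66250, 0.52514, -3.49353, -3.65955, 0.44943, 0.43970, 0.33280, 0.24866, -5.51903, -5.58250, 0.23377] : List ℝ).getD i 0) :
    ∑ i ∈ Finset.range 23, M i * (x (i + 1) - x i) ≤ 1.39499 := by
  simp only [Finset.sum_range_succ, Finset.sum_range_zero, hx, hM, List.getD_cons_succ, List.getD_cons_zero]
  norm_num

/-- **Dispatch of the 23 cells.**  If `D(t) = f(t)·B(e^{t/2}) + 2v²/(v⁴-1)` for `t > 0` and `f` takes the witness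
values (`f = 1` on `(0, 0.28)`, `0 ≤ f ≤ 1` on `(0.28, 0.32)`, `f ≤ 0` beyond `0.32`, `f = -1` on the four
plateaus), then `D ≤ Mᵢ` on the `i`-th cell. -/
theorem cells_dispatch {f D : ℝ → ℝ} {x M : ℕ → ℝ} (hx : x = fun i => ([(0 : ℝ), 0.28, 0.32, 0.36, 0.5, 0.64, 0.68, 0.7, 0.74, 0.86, 0.98, 1.02, 1.2, 1.4, 1.42, 1.48, 1.54, 1.56, 1.82, 2.1, 2.12, 2.14, 2.16, 2.18] : List ℝ).getD i 2.18)
    (hM : M = fun i => ([(4.03928 : ℝ), 3.97114, 3.07231, 1.90855, 0.25749, 1.46073, 1.36310, 1.31826, -1.25283, -1.75979, 0.87370, 0.82900, 0.66250, 0.52514, -3.49353, -3.65955, 0.44943, 0.43970, 0.33280, 0.24866, -5.51903, -5.58250, 0.23377] : List ℝ).getD i 0)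
    (hD : ∀ t, 0 < t → D t = f t * (2 * (Real.exp (t / 2) + (Real.exp (t / 2))⁻¹) - 2 * Real.exp (t / 2) ^ 3 / (Real.exp (t / 2) ^ 4 - 1)) +
        2 * Real.exp (t / 2) ^ 2 / (Real.exp (t / 2) ^ 4 - 1))
    (W_pos1 : ∀ t ∈ Ioo (0 : ℝ) 0.28, f t = 1) (W_possh : ∀ t ∈ Ioo (0.28 : ℝ) 0.32, 0 ≤ f t ∧ f t ≤ 1)
    (W_nonpos : ∀ t, 0.32 ≤ t → f t ≤ 0)
    (W_plateau : ∀ t : ℝ, (t ∈ Icc (0.36 : ℝ) 0.64 → f t = -1) ∧ (t ∈ Icc (0.74 : ℝ) 0.98 → f t = -1) ∧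
      (t ∈ Icc (1.42 : ℝ) 1.54 → f t = -1) ∧ (t ∈ Icc (2.12 : ℝ) 2.16 → f t = -1)) :
    ∀ i < 23, ∀ t ∈ Ioo (x i) (x (i + 1)), D t ≤ M i := by
  intro i hi
  interval_cases i
  · intro t ht
    simp only [hx, hM, List.getD_cons_succ, List.getD_cons_zero] at ht ⊢
    rw [hD t (by linarith [ht.1])]
    exact ncell0 ht (W_pos1 t ht)
  · intro t ht
    simp only [hx, hM, List.getD_cons_succ, List.getD_cons_zero] at ht ⊢
    rw [hD t (by linarith [ht.1])]
    exact ncell1 ht (W_possh t ht).1 (W_possh t ht).2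
  · intro t ht
    simp only [hx, hM, List.getD_cons_succ, List.getD_cons_zero] at ht ⊢
    rw [hD t (by linarith [ht.1])]
    exact ncell2 ht (W_nonpos t (by linarith [ht.1]))
  · intro t ht
    simp only [hx, hM, List.getD_cons_succ, List.getD_cons_zero] at ht ⊢
    rw [hD t (by linarith [ht.1])]
    exact ncell3 ht ((W_plateau t).1 ⟨by linarith [ht.1], by linarith [ht.2]⟩)
  · intro t ht
    simp only [hx, hM, List.getD_cons_succ, List.getD_cons_zero] at ht ⊢
    rw [hD t (by linarith [ht.1])]
    exact ncell4 ht ((W_plateau t).1 ⟨by linarith [ht.1], by linarith [ht.2]⟩)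
  · intro t ht
    simp only [hx, hM, List.getD_cons_succ, List.getD_cons_zero] at ht ⊢
    rw [hD t (by linarith [ht.1])]
    exact ncell5 ht (W_nonpos t (by linarith [ht.1]))
  · intro t ht
    simp only [hx, hM, List.getD_cons_succ, List.getD_cons_zero] at ht ⊢
    rw [hD t (by linarith [ht.1])]
    exact ncell6 ht (W_nonpos t (by linarith [ht.1]))
  · intro t ht
    simp only [hx, hM, List.getD_cons_succ, List.getD_cons_zero] at ht ⊢
    rw [hD t (by linarith [ht.1])]
    exact ncell7 ht (W_nonpos t (by linarith [ht.1]))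
  · intro t ht
    simp only [hx, hM, List.getD_cons_succ, List.getD_cons_zero] at ht ⊢
    rw [hD t (by linarith [ht.1])]
    exact ncell8 ht ((W_plateau t).2.1 ⟨by linarith [ht.1], by linarith [ht.2]⟩)
  · intro t ht
    simp only [hx, hM, List.getD_cons_succ, List.getD_cons_zero] at ht ⊢
    rw [hD t (by linarith [ht.1])]
    exact ncell9 ht ((W_plateau t).2.1 ⟨by linarith [ht.1], by linarith [ht.2]⟩)
  · intro t ht
    simp only [hx, hM, List.getD_cons_succ, List.getD_cons_zero] at ht ⊢
    rw [hD t (by linarith [ht.1])]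
    exact ncell10 ht (W_nonpos t (by linarith [ht.1]))
  · intro t ht
    simp only [hx, hM, List.getD_cons_succ, List.getD_cons_zero] at ht ⊢
    rw [hD t (by linarith [ht.1])]
    exact ncell11 ht (W_nonpos t (by linarith [ht.1]))
  · intro t ht
    simp only [hx, hM, List.getD_cons_succ, List.getD_cons_zero] at ht ⊢
    rw [hD t (by linarith [ht.1])]
    exact ncell12 ht (W_nonpos t (by linarith [ht.1]))
  · intro t ht
    simp only [hx, hM, List.getD_cons_succ, List.getD_cons_zero] at ht ⊢
    rw [hD t (by linarith [ht.1])]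
    exact ncell13 ht (W_nonpos t (by linarith [ht.1]))
  · intro t ht
    simp only [hx, hM, List.getD_cons_succ, List.getD_cons_zero] at ht ⊢
    rw [hD t (by linarith [ht.1])]
    exact ncell14 ht ((W_plateau t).2.2.1 ⟨by linarith [ht.1], by linarith [ht.2]⟩)
  · intro t ht
    simp only [hx, hM, List.getD_cons_succ, List.getD_cons_zero] at ht ⊢
    rw [hD t (by linarith [ht.1])]
    exact ncell15 ht ((W_plateau t).2.2.1 ⟨by linarith [ht.1], by linarith [ht.2]⟩)
  · intro t ht
    simp only [hx, hM, List.getD_cons_succ, List.getD_cons_zero] at ht ⊢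
    rw [hD t (by linarith [ht.1])]
    exact ncell16 ht (W_nonpos t (by linarith [ht.1]))
  · intro t ht
    simp only [hx, hM, List.getD_cons_succ, List.getD_cons_zero] at ht ⊢
    rw [hD t (by linarith [ht.1])]
    exact ncell17 ht (W_nonpos t (by linarith [ht.1]))
  · intro t ht
    simp only [hx, hM, List.getD_cons_succ, List.getD_cons_zero] at ht ⊢
    rw [hD t (by linarith [ht.1])]
    exact ncell18 ht (W_nonpos t (by linarith [ht.1]))
  · intro t ht
    simp only [hx, hM, List.getD_cons_succ, List.getD_cons_zero] at ht ⊢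
    rw [hD t (by linarith [ht.1])]
    exact ncell19 ht (W_nonpos t (by linarith [ht.1]))
  · intro t ht
    simp only [hx, hM, List.getD_cons_succ, List.getD_cons_zero] at ht ⊢
    rw [hD t (by linarith [ht.1])]
    exact ncell20 ht ((W_plateau t).2.2.2 ⟨by linarith [ht.1], by linarith [ht.2]⟩)
  · intro t ht
    simp only [hx, hM, List.getD_cons_succ, List.getD_cons_zero] at ht ⊢
    rw [hD t (by linarith [ht.1])]
    exact ncell21 ht ((W_plateau t).2.2.2 ⟨by linarith [ht.1], by linarith [ht.2]⟩)
  · intro t ht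
    simp only [hx, hM, List.getD_cons_succ, List.getD_cons_zero] at ht ⊢
    rw [hD t (by linarith [ht.1])]
    exact ncell22 ht (W_nonpos t (by linarith [ht.1]))

/-- Anchor of this file on the crux item (registered sub-goal): the budget `log 4π + γ ≥ 2.9849` (`budget_le`). -/
theorem originDominating_budget : (2.9849066 : ℝ) ≤ Real.log (4 * Real.pi) + Real.eulerMascheroniConstant :=
  budget_le

end Summit.RiemannHypothesis.RiemannHypothesis.Theorems.SignConeOscillatory.Negative

end
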